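import Summits.Ventures.CertifiedManyBodySolver.Downfold.TPrimePinnedPairRowKernel
import Summits.Ventures.CertifiedManyBodySolver.Downfold.BoxReadPinnedPairTPrime
import HarnessLib

/-!
# PINNED `t′`-PAIR nodes‴ (density-affine WN / objective-FAMILY editions) ⇐ TWO WINDOW IDENTITIES WITH SHARED EQUATION-OF-MOTION WORDS
# — the WN-family TWIN of hubbard-cov-la214-unc-2's `SquareTTPrimePinnedPairRowT.of_windowIdentities`, BY IMPORT of its core lemma

Venture CertifiedManyBodySolver; cell `hubbard-obs` / D-0154 (1)(C) COVERAGE; seat `hubbard-cov-la214-box-2` (g2). Captain hubbard-cov-la214-plan-1 g2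
RULING «collision #4» (hubbard-obs STATUS 2026-08-28T20:30:54Z): ONE core writer (hubbard-cov-la214-unc-2 g6, `Downfold/TPrimePinnedPairRowKernel.lean`:
the shape-free vertex-transport lemma `pinnedVertexRow_of_windowIdentity` — a `t–t′` window certificate identity at `(1, s_v, U)` evaluated on a
torus-limit ground state at `(1, s, U)` of any filling, with the equation-of-motion functional RETAINED — and `pinnedStationarity`), the density-affine /
objective-family pair SHAPES of hubbard-cov-ndnio2-box-1 (`TPrimePinnedPairFamilyRowWN`, `TPrimePinnedPairRowWN`, `Downfold/BoxReadPinnedPairTPrime{,Family}.lean`)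
get their «two certificates ⇒ pair node‴» theorem HERE as corollaries — nothing of the core is restated.

* `TPrimePinnedPairFamilyRowWN.of_window_certificates` — TWO window identities in `𝔄_{box 2 7}` (vertex A at `(1, s_A, U)` with objective `X s_A`, vertex B
  at `(1, s_B, U)` with `X s_B`; Gram / affine-`D₄` / charged / anti-Hermitian / residual families per vertex) using THE SAME eom words `{B_k}` (what
  `pinfold` makes literally true for a hub′/pinned-spoke pair), with `β_v ≤ c_v − Σ‖a_v‖ + (Σ_σ μ_{vσ})(n₀/2 − ν_v)` and `sl_v = ½Σ_σ μ_{vσ}` ⟹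
  `TPrimePinnedPairFamilyRowWN U s_A s_B c_A c_B fl_A fl_B β_A κ_A κ_A' sl_A β_B κ_B κ_B' sl_B n₀ X` — at EVERY filling `x ∈ [0, 2)` (the density rows'
  `(Σμ)(x/2 − ν)` splits as `(Σμ)(n₀/2 − ν) + sl·(x − n₀)`), the vertex energies being `e_{Φ(1,s_v,U)}(ω) = e₀(1,s,U,x) + (s_v − s)·e_{Φ(0,1,0)}(ω)`
  (`meanEnergy_hubbardTTPrime_affine`, `IsTorusLimitOf.meanEnergy_hubbardTTPrime_eq_energyDensityTT'`); witnesses `E₀, E₁` = the core's two orbit means.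
* `TPrimePinnedPairRowWN.of_window_certificates` — the constant-objective shape (`TPrimePinnedPairRowWN_iff_family`): every NdNiO₂ / Hg / La214-`Po` pair.

CONSEQUENCE: with hubbard-obs-p2's syntactic layer (exporter + one `lowerConst (normalize …)` evaluation per vertex, ONE shared eom word list), a pair node‴
of record (La214 M2(c) `cert_lsco_pair_{M1pHub_Po,hubM4_Oi}_up`, NdNiO₂ `…pairs_ABC_P`, …) becomes a KERNEL theorem — no pair-level computation. NOT addressed:
SU(2)-Ward rows (no `[S^±, ·]` slot; hubbard-obs-p2 SCOPE NOTE 2026-08-28T20:09:51Z).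
HONEST FRAMING: soundness plumbing about claim-node SHAPES; evaluates NO certificate, discharges NO node; no number of record, tier, hold, registry row or
box word changes; CONTROL / CALIBRATION class (xx1); a ceiling never speaks to the presence or absence of superconductivity; no `T_c` / phase sentence; no
item, rung leaf or summit statement is proved here. Zero compute.

References: J. Wang et al., PRX 14 (2024) 031006, §III [cite: WangEtAl2024, §III]; S. Boyd, L. Vandenberghe, *Convex Optimization* (2004) §5.9
[cite: BoydVandenberghe2004, §5.9]; O. Bratteli, A. Kishimoto, D. W. Robinson, CMP 64 (1978) 41 [cite: BratteliKishimotoRobinson1978, §3 (mean energy functional)].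
-/

noncomputable section

namespace Summit.Ventures.CertifiedManyBodySolver.Downfold

open Set Filter Topology Finset
open Literature.MathematicalPhysics.QuantumLattice Literature.MathematicalPhysics.QuantumLattice.ThermodynamicLimit
open Literature.MathematicalPhysics.QuantumLattice.InfVolFermionState
open Literature.MathematicalPhysics.QuantumManyBody.StateRelaxation
open Literature.Probability.LatticeModels
open Matrix HubbardWave0
open scoped BigOperators ComplexOrder

/-- **PINNED `t′`-PAIR node‴ (objective-FAMILY, density-affine edition) ⇐ two window identities sharing the eom words** — the WN-family twin of
`SquareTTPrimePinnedPairRowT.of_windowIdentities`; (E) = `pinnedStationarity`, (V_A)/(V_B) = `pinnedVertexRow_of_windowIdentity` at the state's filling `x`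
with the vertex energy rewritten as `e_{Φ(1,s_v,U)}(ω)`. [cite: WangEtAl2024, §III] [cite: BoydVandenberghe2004, §5.9] -/
theorem TPrimePinnedPairFamilyRowWN.of_window_certificates
    {U : ℝ} (hU : 0 ≤ U) {sA sB : ℝ}
    (X : ℝ → FermionOp (Literature.Probability.LatticeModels.box 2 7))
    {Λ : Finset (Site 2)} (hΛ : Λ ⊆ Literature.Probability.LatticeModels.box 2 7)
    (h8 : thicken Λ 1 ⊆ Literature.Probability.LatticeModels.box 2 7)
    (h0 : thicken ({0} : Finset (Site 2)) 1 ⊆ Literature.Probability.LatticeModels.box 2 7)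
    (hz : (0 : Site 2) ∈ Literature.Probability.LatticeModels.box 2 7)
    -- the SHARED equation-of-motion family
    {κ' : Type*} (sE : Finset κ') (B : κ' → FermionOp Λ)
    -- the pair slots
    {cA cB flA flB βA κA κA' slA βB κB κB' slB n₀ : ℚ}
    -- vertex A
    (μA : Fin 2 → ℝ) (νA : ℝ)
    {mA : Type*} [Fintype mA] [DecidableEq mA] {ΛmA : Matrix mA mA ℂ} (hΛmA : ΛmA.PosSemidef)
    (OA : mA → FermionOp (Literature.Probability.LatticeModels.box 2 7))
    {ιA : Type*} (ttA : Finset ιA) (γA : ιA → DihedralGroup 4) (wvA : ιA → Site 2)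
    (hshA : ∀ l, d4ShiftSet (γA l) (wvA l) Λ ⊆ Literature.Probability.LatticeModels.box 2 7) (YA : ιA → FermionOp Λ)
    {ρA : Type*} (uuA : Finset ρA) (bA : ρA → ℂ) (cwA : ρA → List (Orb (PolySite (Literature.Probability.LatticeModels.box 2 7)) × Bool))
    (hcwA : ∀ j ∈ uuA, ladderCharge (cwA j) ≠ 0 ∨ ladderSpinCharge (cwA j) ≠ 0)
    {δA : Type*} (ahA : Finset δA) (dcA : δA → ℝ) (VA : δA → FermionOp (Literature.Probability.LatticeModels.box 2 7))
    {κA'' : Type*} (wA : Finset κA'') (aA : κA'' → ℂ) (wordA : κA'' → List (Orb (PolySite (Literature.Probability.LatticeModels.box 2 7)) × Bool))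
    {c0A : ℝ}
    (hcertA : X sA - (c0A : ℂ) • (1 : FermionOp (Literature.Probability.LatticeModels.box 2 7)) -
        ∑ σ : Fin 2, ((μA σ : ℝ) : ℂ) • (nAt 0 hz σ - ((νA : ℝ) : ℂ) • (1 : FermionOp (Literature.Probability.LatticeModels.box 2 7))) -
        (((κA : ℚ) : ℝ) : ℂ) • ((((cA : ℚ) : ℝ) : ℂ) • (1 : FermionOp (Literature.Probability.LatticeModels.box 2 7)) -
          fermionEmbed (PolySite.incl h0) ((hubbardTTPrimeFermionInteraction 1 sA U).meanEnergyObs 1)) -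
        (((κA' : ℚ) : ℝ) : ℂ) • (fermionEmbed (PolySite.incl h0) ((hubbardTTPrimeFermionInteraction 1 sA U).meanEnergyObs 1) -
          (((flA : ℚ) : ℝ) : ℂ) • (1 : FermionOp (Literature.Probability.LatticeModels.box 2 7))) =
      gramForm ΛmA OA +
        (∑ k ∈ sE, ((hubbardTTPrimeFermionInteraction 1 sA U).localHamiltonian (Literature.Probability.LatticeModels.box 2 7) *
              fermionEmbed (PolySite.incl hΛ) (B k) -
            fermionEmbed (PolySite.incl hΛ) (B k) *
              (hubbardTTPrimeFermionInteraction 1 sA U).localHamiltonian (Literature.Probability.LatticeModels.box 2 7)) +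
          ∑ l ∈ ttA, (fermionEmbed (PolySite.incl (hshA l)) (fermionEmbed (PolySite.d4Emb (γA l) (wvA l) Λ) (YA l)) -
            fermionEmbed (PolySite.incl hΛ) (YA l)) +
          ∑ j ∈ uuA, bA j • ladderWord (cwA j)) +
        (∑ m' ∈ ahA, ((dcA m' : ℝ) : ℂ) • ((VA m')ᴴ - VA m') + ∑ k ∈ wA, aA k • ladderWord (wordA k)))
    (hβA : ((βA : ℚ) : ℝ) ≤ c0A - ∑ k ∈ wA, ‖aA k‖ + (∑ σ : Fin 2, μA σ) * (((n₀ : ℚ) : ℝ) / 2 - νA))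
    (hslA : ((slA : ℚ) : ℝ) = (∑ σ : Fin 2, μA σ) / 2)
    -- vertex B
    (μB : Fin 2 → ℝ) (νB : ℝ)
    {mB : Type*} [Fintype mB] [DecidableEq mB] {ΛmB : Matrix mB mB ℂ} (hΛmB : ΛmB.PosSemidef)
    (OB : mB → FermionOp (Literature.Probability.LatticeModels.box 2 7))
    {ιB : Type*} (ttB : Finset ιB) (γB : ιB → DihedralGroup 4) (wvB : ιB → Site 2)
    (hshB : ∀ l, d4ShiftSet (γB l) (wvB l) Λ ⊆ Literature.Probability.LatticeModels.box 2 7) (YB : ιB → FermionOp Λ)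
    {ρB : Type*} (uuB : Finset ρB) (bB : ρB → ℂ) (cwB : ρB → List (Orb (PolySite (Literature.Probability.LatticeModels.box 2 7)) × Bool))
    (hcwB : ∀ j ∈ uuB, ladderCharge (cwB j) ≠ 0 ∨ ladderSpinCharge (cwB j) ≠ 0)
    {δB : Type*} (ahB : Finset δB) (dcB : δB → ℝ) (VB : δB → FermionOp (Literature.Probability.LatticeModels.box 2 7))
    {κB'' : Type*} (wB : Finset κB'') (aB : κB'' → ℂ) (wordB : κB'' → List (Orb (PolySite (Literature.Probability.LatticeModels.box 2 7)) × Bool))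
    {c0B : ℝ}
    (hcertB : X sB - (c0B : ℂ) • (1 : FermionOp (Literature.Probability.LatticeModels.box 2 7)) -
        ∑ σ : Fin 2, ((μB σ : ℝ) : ℂ) • (nAt 0 hz σ - ((νB : ℝ) : ℂ) • (1 : FermionOp (Literature.Probability.LatticeModels.box 2 7))) -
        (((κB : ℚ) : ℝ) : ℂ) • ((((cB : ℚ) : ℝ) : ℂ) • (1 : FermionOp (Literature.Probability.LatticeModels.box 2 7)) -
          fermionEmbed (PolySite.incl h0) ((hubbardTTPrimeFermionInteraction 1 sB U).meanEnergyObs 1)) -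
        (((κB' : ℚ) : ℝ) : ℂ) • (fermionEmbed (PolySite.incl h0) ((hubbardTTPrimeFermionInteraction 1 sB U).meanEnergyObs 1) -
          (((flB : ℚ) : ℝ) : ℂ) • (1 : FermionOp (Literature.Probability.LatticeModels.box 2 7))) =
      gramForm ΛmB OB +
        (∑ k ∈ sE, ((hubbardTTPrimeFermionInteraction 1 sB U).localHamiltonian (Literature.Probability.LatticeModels.box 2 7) *
              fermionEmbed (PolySite.incl hΛ) (B k) -
            fermionEmbed (PolySite.incl hΛ) (B k) *
              (hubbardTTPrimeFermionInteraction 1 sB U).localHamiltonian (Literature.Probability.LatticeModels.box 2 7)) +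
          ∑ l ∈ ttB, (fermionEmbed (PolySite.incl (hshB l)) (fermionEmbed (PolySite.d4Emb (γB l) (wvB l) Λ) (YB l)) -
            fermionEmbed (PolySite.incl hΛ) (YB l)) +
          ∑ j ∈ uuB, bB j • ladderWord (cwB j)) +
        (∑ m' ∈ ahB, ((dcB m' : ℝ) : ℂ) • ((VB m')ᴴ - VB m') + ∑ k ∈ wB, aB k • ladderWord (wordB k)))
    (hβB : ((βB : ℚ) : ℝ) ≤ c0B - ∑ k ∈ wB, ‖aB k‖ + (∑ σ : Fin 2, μB σ) * (((n₀ : ℚ) : ℝ) / 2 - νB))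
    (hslB : ((slB : ℚ) : ℝ) = (∑ σ : Fin 2, μB σ) / 2) :
    TPrimePinnedPairFamilyRowWN U sA sB cA cB flA flB βA κA κA' slA βB κB κB' slB n₀ X := by
  have h1S : (1 : DihedralGroup 4) ∈ (Finset.univ : Finset (DihedralGroup 4)) := Finset.mem_univ _
  have hmulS : ∀ a ∈ (Finset.univ : Finset (DihedralGroup 4)), ∀ b ∈ (Finset.univ : Finset (DihedralGroup 4)),
      a * b ∈ (Finset.univ : Finset (DihedralGroup 4)) := fun _ _ _ _ => Finset.mem_univ _
  refine ⟨fun ω => ((Finset.univ : Finset (DihedralGroup 4)).card : ℝ)⁻¹ * ∑ g ∈ (Finset.univ : Finset (DihedralGroup 4)),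
      (ω.expect (d4ShiftSet g 0 (Literature.Probability.LatticeModels.box 2 7))
        (fermionEmbed (PolySite.d4Emb g 0 (Literature.Probability.LatticeModels.box 2 7))
          (∑ k ∈ sE, ((hubbardTTPrimeFermionInteraction 1 0 U).localHamiltonian (Literature.Probability.LatticeModels.box 2 7) *
              fermionEmbed (PolySite.incl hΛ) (B k) -
            fermionEmbed (PolySite.incl hΛ) (B k) *
              (hubbardTTPrimeFermionInteraction 1 0 U).localHamiltonian (Literature.Probability.LatticeModels.box 2 7))))).re,
    fun ω => ((Finset.univ : Finset (DihedralGroup 4)).card : ℝ)⁻¹ * ∑ g ∈ (Finset.univ : Finset (DihedralGroup 4)),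
      (ω.expect (d4ShiftSet g 0 (Literature.Probability.LatticeModels.box 2 7))
        (fermionEmbed (PolySite.d4Emb g 0 (Literature.Probability.LatticeModels.box 2 7))
          (∑ k ∈ sE, ((hubbardTTPrimeFermionInteraction 0 1 0).localHamiltonian (Literature.Probability.LatticeModels.box 2 7) *
              fermionEmbed (PolySite.incl hΛ) (B k) -
            fermionEmbed (PolySite.incl hΛ) (B k) *
              (hubbardTTPrimeFermionInteraction 0 1 0).localHamiltonian (Literature.Probability.LatticeModels.box 2 7))))).re,
    fun s _ x hx0 hx2 ω Ls ψ hLs hψ hψ1 hω => ⟨?_, ?_, ?_⟩⟩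
  · exact pinnedStationarity hU hx0 hx2 s hΛ h8 h0 hz h1S hmulS sE B hLs hψ hψ1 hω
  · have h := pinnedVertexRow_of_windowIdentity hU hx0 hx2 sA s hΛ h8 h0 hz h1S hmulS (X sA) μA νA cA flA κA κA' hΛmA OA sE B
      ttA γA (fun _ _ => Finset.mem_univ _) wvA hshA YA uuA bA cwA hcwA ahA dcA VA wA aA wordA hcertA hLs hψ hψ1 hω
    have hGS : ω.meanEnergy (hubbardTTPrimeFermionInteraction 1 s U) 1 = energyDensityTT' 1 s U x :=
      hω.meanEnergy_hubbardTTPrime_eq_energyDensityTT' 1 s hU hx0 hx2 hLs hψ hψ1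
    have hEA : ω.meanEnergy (hubbardTTPrimeFermionInteraction 1 sA U) 1 =
        energyDensityTT' 1 s U x + (sA - s) * ω.meanEnergy (hubbardTTPrimeFermionInteraction 0 1 0) 1 := by
      rw [ω.meanEnergy_hubbardTTPrime_affine 1 s U sA U, hGS]; ring
    have hμ : ((slA : ℚ) : ℝ) * (x - ((n₀ : ℚ) : ℝ)) + (∑ σ : Fin 2, μA σ) * (((n₀ : ℚ) : ℝ) / 2 - νA) =
        (∑ σ : Fin 2, μA σ) * (x / 2 - νA) := by rw [hslA]; ring
    unfold tPrimeObjOrbitMean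
    rw [hEA]
    dsimp only
    have e1 : ((κA : ℚ) : ℝ) * (((cA : ℚ) : ℝ) - (energyDensityTT' 1 s U x + (sA - s) * ω.meanEnergy (hubbardTTPrimeFermionInteraction 0 1 0) 1)) =
        ((κA : ℚ) : ℝ) * (((cA : ℚ) : ℝ) - energyDensityTT' 1 s U x + (s - sA) * ω.meanEnergy (hubbardTTPrimeFermionInteraction 0 1 0) 1) := by ring
    have e2 : ((κA' : ℚ) : ℝ) * (energyDensityTT' 1 s U x + (sA - s) * ω.meanEnergy (hubbardTTPrimeFermionInteraction 0 1 0) 1 - ((flA : ℚ) : ℝ)) =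
        ((κA' : ℚ) : ℝ) * (energyDensityTT' 1 s U x - (s - sA) * ω.meanEnergy (hubbardTTPrimeFermionInteraction 0 1 0) 1 - ((flA : ℚ) : ℝ)) := by ring
    linarith [h, hμ, hβA, e1, e2]
  · have h := pinnedVertexRow_of_windowIdentity hU hx0 hx2 sB s hΛ h8 h0 hz h1S hmulS (X sB) μB νB cB flB κB κB' hΛmB OB sE B
      ttB γB (fun _ _ => Finset.mem_univ _) wvB hshB YB uuB bB cwB hcwB ahB dcB VB wB aB wordB hcertB hLs hψ hψ1 hω
    have hGS : ω.meanEnergy (hubbardTTPrimeFermionInteraction 1 s U) 1 = energyDensityTT' 1 s U x :=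
      hω.meanEnergy_hubbardTTPrime_eq_energyDensityTT' 1 s hU hx0 hx2 hLs hψ hψ1
    have hEB : ω.meanEnergy (hubbardTTPrimeFermionInteraction 1 sB U) 1 =
        energyDensityTT' 1 s U x + (sB - s) * ω.meanEnergy (hubbardTTPrimeFermionInteraction 0 1 0) 1 := by
      rw [ω.meanEnergy_hubbardTTPrime_affine 1 s U sB U, hGS]; ring
    have hμ : ((slB : ℚ) : ℝ) * (x - ((n₀ : ℚ) : ℝ)) + (∑ σ : Fin 2, μB σ) * (((n₀ : ℚ) : ℝ) / 2 - νB) =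
        (∑ σ : Fin 2, μB σ) * (x / 2 - νB) := by rw [hslB]; ring
    unfold tPrimeObjOrbitMean
    rw [hEB]
    dsimp only
    have e1 : ((κB : ℚ) : ℝ) * (((cB : ℚ) : ℝ) - (energyDensityTT' 1 s U x + (sB - s) * ω.meanEnergy (hubbardTTPrimeFermionInteraction 0 1 0) 1)) =
        ((κB : ℚ) : ℝ) * (((cB : ℚ) : ℝ) - energyDensityTT' 1 s U x + (s - sB) * ω.meanEnergy (hubbardTTPrimeFermionInteraction 0 1 0) 1) := by ring
    have e2 : ((κB' : ℚ) : ℝ) * (energyDensityTT' 1 s U x + (sB - s) * ω.meanEnergy (hubbardTTPrimeFermionInteraction 0 1 0) 1 - ((flB : ℚ) : ℝ)) =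
        ((κB' : ℚ) : ℝ) * (energyDensityTT' 1 s U x - (s - sB) * ω.meanEnergy (hubbardTTPrimeFermionInteraction 0 1 0) 1 - ((flB : ℚ) : ℝ)) := by ring
    linarith [h, hμ, hβB, e1, e2]

/-- **Constant-objective edition**: the same for `TPrimePinnedPairRowWN … X₀` (both certificates bound the SAME word `X₀`; every NdNiO₂ / Hg / La214-`Po`
pair), via `TPrimePinnedPairRowWN_iff_family`. [cite: WangEtAl2024, §III] [cite: BoydVandenberghe2004, §5.9] -/
theorem TPrimePinnedPairRowWN.of_window_certificates
    {U : ℝ} (hU : 0 ≤ U) {sA sB : ℝ}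
    (X₀ : FermionOp (Literature.Probability.LatticeModels.box 2 7))
    {Λ : Finset (Site 2)} (hΛ : Λ ⊆ Literature.Probability.LatticeModels.box 2 7)
    (h8 : thicken Λ 1 ⊆ Literature.Probability.LatticeModels.box 2 7)
    (h0 : thicken ({0} : Finset (Site 2)) 1 ⊆ Literature.Probability.LatticeModels.box 2 7)
    (hz : (0 : Site 2) ∈ Literature.Probability.LatticeModels.box 2 7)
    {κ' : Type*} (sE : Finset κ') (B : κ' → FermionOp Λ)
    {cA cB flA flB βA κA κA' slA βB κB κB' slB n₀ : ℚ}
    (μA : Fin 2 → ℝ) (νA : ℝ)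
    {mA : Type*} [Fintype mA] [DecidableEq mA] {ΛmA : Matrix mA mA ℂ} (hΛmA : ΛmA.PosSemidef)
    (OA : mA → FermionOp (Literature.Probability.LatticeModels.box 2 7))
    {ιA : Type*} (ttA : Finset ιA) (γA : ιA → DihedralGroup 4) (wvA : ιA → Site 2)
    (hshA : ∀ l, d4ShiftSet (γA l) (wvA l) Λ ⊆ Literature.Probability.LatticeModels.box 2 7) (YA : ιA → FermionOp Λ)
    {ρA : Type*} (uuA : Finset ρA) (bA : ρA → ℂ) (cwA : ρA → List (Orb (PolySite (Literature.Probability.LatticeModels.box 2 7)) × Bool))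
    (hcwA : ∀ j ∈ uuA, ladderCharge (cwA j) ≠ 0 ∨ ladderSpinCharge (cwA j) ≠ 0)
    {δA : Type*} (ahA : Finset δA) (dcA : δA → ℝ) (VA : δA → FermionOp (Literature.Probability.LatticeModels.box 2 7))
    {κA'' : Type*} (wA : Finset κA'') (aA : κA'' → ℂ) (wordA : κA'' → List (Orb (PolySite (Literature.Probability.LatticeModels.box 2 7)) × Bool))
    {c0A : ℝ}
    (hcertA : X₀ - (c0A : ℂ) • (1 : FermionOp (Literature.Probability.LatticeModels.box 2 7)) -
        ∑ σ : Fin 2, ((μA σ : ℝ) : ℂ) • (nAt 0 hz σ - ((νA : ℝ) : ℂ) • (1 : FermionOp (Literature.Probability.LatticeModels.box 2 7))) -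
        (((κA : ℚ) : ℝ) : ℂ) • ((((cA : ℚ) : ℝ) : ℂ) • (1 : FermionOp (Literature.Probability.LatticeModels.box 2 7)) -
          fermionEmbed (PolySite.incl h0) ((hubbardTTPrimeFermionInteraction 1 sA U).meanEnergyObs 1)) -
        (((κA' : ℚ) : ℝ) : ℂ) • (fermionEmbed (PolySite.incl h0) ((hubbardTTPrimeFermionInteraction 1 sA U).meanEnergyObs 1) -
          (((flA : ℚ) : ℝ) : ℂ) • (1 : FermionOp (Literature.Probability.LatticeModels.box 2 7))) =
      gramForm ΛmA OA +
        (∑ k ∈ sE, ((hubbardTTPrimeFermionInteraction 1 sA U).localHamiltonian (Literature.Probability.LatticeModels.box 2 7) *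
              fermionEmbed (PolySite.incl hΛ) (B k) -
            fermionEmbed (PolySite.incl hΛ) (B k) *
              (hubbardTTPrimeFermionInteraction 1 sA U).localHamiltonian (Literature.Probability.LatticeModels.box 2 7)) +
          ∑ l ∈ ttA, (fermionEmbed (PolySite.incl (hshA l)) (fermionEmbed (PolySite.d4Emb (γA l) (wvA l) Λ) (YA l)) -
            fermionEmbed (PolySite.incl hΛ) (YA l)) +
          ∑ j ∈ uuA, bA j • ladderWord (cwA j)) +
        (∑ m' ∈ ahA, ((dcA m' : ℝ) : ℂ) • ((VA m')ᴴ - VA m') + ∑ k ∈ wA, aA k • ladderWord (wordA k)))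
    (hβA : ((βA : ℚ) : ℝ) ≤ c0A - ∑ k ∈ wA, ‖aA k‖ + (∑ σ : Fin 2, μA σ) * (((n₀ : ℚ) : ℝ) / 2 - νA))
    (hslA : ((slA : ℚ) : ℝ) = (∑ σ : Fin 2, μA σ) / 2)
    (μB : Fin 2 → ℝ) (νB : ℝ)
    {mB : Type*} [Fintype mB] [DecidableEq mB] {ΛmB : Matrix mB mB ℂ} (hΛmB : ΛmB.PosSemidef)
    (OB : mB → FermionOp (Literature.Probability.LatticeModels.box 2 7))
    {ιB : Type*} (ttB : Finset ιB) (γB : ιB → DihedralGroup 4) (wvB : ιB → Site 2)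
    (hshB : ∀ l, d4ShiftSet (γB l) (wvB l) Λ ⊆ Literature.Probability.LatticeModels.box 2 7) (YB : ιB → FermionOp Λ)
    {ρB : Type*} (uuB : Finset ρB) (bB : ρB → ℂ) (cwB : ρB → List (Orb (PolySite (Literature.Probability.LatticeModels.box 2 7)) × Bool))
    (hcwB : ∀ j ∈ uuB, ladderCharge (cwB j) ≠ 0 ∨ ladderSpinCharge (cwB j) ≠ 0)
    {δB : Type*} (ahB : Finset δB) (dcB : δB → ℝ) (VB : δB → FermionOp (Literature.Probability.LatticeModels.box 2 7))
    {κB'' : Type*} (wB : Finset κB'') (aB : κB'' → ℂ) (wordB : κB'' → List (Orb (PolySite (Literature.Probability.LatticeModels.box 2 7)) × Bool))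
    {c0B : ℝ}
    (hcertB : X₀ - (c0B : ℂ) • (1 : FermionOp (Literature.Probability.LatticeModels.box 2 7)) -
        ∑ σ : Fin 2, ((μB σ : ℝ) : ℂ) • (nAt 0 hz σ - ((νB : ℝ) : ℂ) • (1 : FermionOp (Literature.Probability.LatticeModels.box 2 7))) -
        (((κB : ℚ) : ℝ) : ℂ) • ((((cB : ℚ) : ℝ) : ℂ) • (1 : FermionOp (Literature.Probability.LatticeModels.box 2 7)) -
          fermionEmbed (PolySite.incl h0) ((hubbardTTPrimeFermionInteraction 1 sB U).meanEnergyObs 1)) -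
        (((κB' : ℚ) : ℝ) : ℂ) • (fermionEmbed (PolySite.incl h0) ((hubbardTTPrimeFermionInteraction 1 sB U).meanEnergyObs 1) -
          (((flB : ℚ) : ℝ) : ℂ) • (1 : FermionOp (Literature.Probability.LatticeModels.box 2 7))) =
      gramForm ΛmB OB +
        (∑ k ∈ sE, ((hubbardTTPrimeFermionInteraction 1 sB U).localHamiltonian (Literature.Probability.LatticeModels.box 2 7) *
              fermionEmbed (PolySite.incl hΛ) (B k) -
            fermionEmbed (PolySite.incl hΛ) (B k) *
              (hubbardTTPrimeFermionInteraction 1 sB U).localHamiltonian (Literature.Probability.LatticeModels.box 2 7)) +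
          ∑ l ∈ ttB, (fermionEmbed (PolySite.incl (hshB l)) (fermionEmbed (PolySite.d4Emb (γB l) (wvB l) Λ) (YB l)) -
            fermionEmbed (PolySite.incl hΛ) (YB l)) +
          ∑ j ∈ uuB, bB j • ladderWord (cwB j)) +
        (∑ m' ∈ ahB, ((dcB m' : ℝ) : ℂ) • ((VB m')ᴴ - VB m') + ∑ k ∈ wB, aB k • ladderWord (wordB k)))
    (hβB : ((βB : ℚ) : ℝ) ≤ c0B - ∑ k ∈ wB, ‖aB k‖ + (∑ σ : Fin 2, μB σ) * (((n₀ : ℚ) : ℝ) / 2 - νB))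
    (hslB : ((slB : ℚ) : ℝ) = (∑ σ : Fin 2, μB σ) / 2) :
    TPrimePinnedPairRowWN U sA sB cA cB flA flB βA κA κA' slA βB κB κB' slB n₀ X₀ :=
  (TPrimePinnedPairRowWN_iff_family).2
    (TPrimePinnedPairFamilyRowWN.of_window_certificates hU (fun _ => X₀) hΛ h8 h0 hz sE B μA νA hΛmA OA ttA γA wvA hshA YA
      uuA bA cwA hcwA ahA dcA VA wA aA wordA hcertA hβA hslA μB νB hΛmB OB ttB γB wvB hshB YB uuB bB cwB hcwB ahB dcB VB
      wB aB wordB hcertB hβB hslB)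

end Summit.Ventures.CertifiedManyBodySolver.Downfold

end
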